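import Literature.Analysis.Distribution.ExpLinearEstimates
import Literature.Analysis.Distribution.FourierLaplaceCone
import Mathlib.Topology.MetricSpace.Thickening
import HarnessLib

/-!
# Estimates for cut-off exponential kernels and geometry of polar cones

Topic `Literature/Analysis/Distribution`. Second brick of the proof of the Fourier–Laplace
representation of cone-supported tempered distributions (`fourierLaplace_coneSupport`,
Hörmander Thm. 7.4.2 / Streater–Wightman Thms. 2-6–2-9; sibling files). The holomorphic function
is `F(z) = u(ξ ↦ χ(ξ) e^{-2πi⟨ξ,z⟩})` with `u = 𝓕⁻¹T` supported in the closed convex cone `S` and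
`χ` a smooth cutoff with bounded derivatives, `= 1` near `S` and supported in the uniform
neighbourhood `S + B(0,3)` (`exists_smooth_cutoff`). Everything about `F` reduces to seminorm
estimates for functions `ξ ↦ χ(ξ) e^{ℓ(ξ)} G(ℓ'(ξ))` with continuous `ℝ`-linear forms
`ℓ, ℓ' : V → ℂ` such that `Re ℓ ≤ A − c‖·‖` on `tsupport χ`. Here (all theorem-only, [folklore]):

* `norm_iteratedFDeriv_cutoff_cexp_le` (the kernel): `‖Dⁿ(χ eˡ)(x)‖ ≤ 2ⁿ B (1+‖ℓ‖)ⁿ eᴬ e^{-c‖x‖}`;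
* `norm_iteratedFDeriv_cutoff_cexp_remainder_le` (second-order remainder in `ℓ'`, for the
  complex derivative of `F`): `‖Dⁿ(χ eˡ (e^{ℓ'} − 1 − ℓ'))(x)‖ ≤ 4ⁿ B (1+‖ℓ‖)ⁿ eᴬ ‖ℓ'‖² (1+‖x‖)²
  e^{-(c/2)‖x‖}` when `‖ℓ'‖ ≤ min 1 (c/2)`;
* `norm_iteratedFDeriv_cutoff_sub_one_mul_le` (for the boundary value `t → 0⁺`):
  `‖Dⁿ(χ (e^{ℓ'} − 1) ψ)(x)‖ ≤ 4ⁿ B ‖ℓ'‖ (1+‖x‖) e^{max(A',0)} B_ψ` when `Re ℓ' ≤ A'` on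
  `tsupport χ`, `‖ℓ'‖ ≤ 1` and `‖Dⁱψ(x)‖ ≤ B_ψ` (`i ≤ n`);
* geometry of the polar cone `S⁻` (`polarCone`, `FourierLaplaceCone`): positive multiples stay in
  the interior (`smul_mem_interior_polarCone`); on a compact subset `M` of the interior,
  `⟪y, ξ⟫ ≤ −r‖ξ‖` on `S` uniformly in `y ∈ M` (`exists_forall_inner_le_neg_mul_norm`, Hörmander's
  "`H_S(θ) < ∞` iff `θ ∈ S⁻`" made quantitative), hence `⟪y, ξ⟫ ≤ −r‖ξ‖ + δ(r + ‖y‖)` on the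
  uniform neighbourhood `thickening δ S` (`inner_le_of_mem_thickening`).

## References

* L. Hörmander, *The Analysis of Linear Partial Differential Operators I*, 2nd ed., §7.4,
  proof of Thm. 7.4.2 and the paragraph before Thm. 7.4.3. [HormanderALPDO1]
* R. F. Streater, A. S. Wightman, *PCT, Spin and Statistics, and All That*, §2-3, proof of
  Thm. 2-6 (the functions `a(p, η)`, `b(p, q)` with bounded derivatives). [StreaterWightman1964]
-/

noncomputable section

open Set Filter Metric
open _root_.Complex (exp)
open scoped ContDiff Topology RealInnerProductSpace

namespace Literature.Analysis.Distribution

/-! ### Cut-off exponential kernels -/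

section Kernel

variable {V : Type*} [NormedAddCommGroup V] [NormedSpace ℝ V]

/-- The complexified cutoff has the same derivative norms. [folklore] -/
theorem norm_iteratedFDeriv_ofReal_comp {χ : V → ℝ} (hχ : ContDiff ℝ ∞ χ) (i : ℕ) (x : V) :
    ‖iteratedFDeriv ℝ i (fun y => (χ y : ℂ)) x‖ = ‖iteratedFDeriv ℝ i χ x‖ :=
  Complex.ofRealLI.norm_iteratedFDeriv_comp_left (hχ.contDiffAt (x := x)) (by exact_mod_cast le_top)

/-- The complexified cutoff is smooth. [folklore] -/
theorem contDiff_ofReal_comp {χ : V → ℝ} (hχ : ContDiff ℝ ∞ χ) : ContDiff ℝ ∞ fun y => (χ y : ℂ) :=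
  Complex.ofRealCLM.contDiff.comp hχ

/-- Derivatives of a function vanish off its topological support. [folklore] -/
theorem iteratedFDeriv_eq_zero_of_notMem_tsupport {F : Type*} [NormedAddCommGroup F]
    [NormedSpace ℝ F] {f : V → F} {x : V} (hx : x ∉ tsupport f) (n : ℕ) :
    iteratedFDeriv ℝ n f x = 0 := by
  by_contra h
  exact hx (support_iteratedFDeriv_subset n (Function.mem_support.2 h))

/-- **The kernel estimate**: for a smooth cutoff `χ` with `‖Dⁱχ‖ ≤ B` (`i ≤ n`) and a continuous
`ℝ`-linear form `ℓ : V → ℂ` with `Re ℓ(x) ≤ A − c‖x‖` on `tsupport χ`,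
`‖Dⁿ(χ eˡ)(x)‖ ≤ 2ⁿ B (1 + ‖ℓ‖)ⁿ eᴬ e^{-c‖x‖}` for all `x` (Leibniz, `‖Dⁱeˡ‖ ≤ e^{Re ℓ}‖ℓ‖ⁱ`;
off `tsupport χ` the derivative vanishes). [folklore] -/
theorem norm_iteratedFDeriv_cutoff_cexp_le {χ : V → ℝ} (hχ : ContDiff ℝ ∞ χ) {n : ℕ} {B : ℝ}
    (hB : ∀ i ≤ n, ∀ x, ‖iteratedFDeriv ℝ i χ x‖ ≤ B) (ℓ : V →L[ℝ] ℂ) {c A : ℝ}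
    (hℓ : ∀ x ∈ tsupport χ, (ℓ x).re ≤ A - c * ‖x‖) (x : V) :
    ‖iteratedFDeriv ℝ n (fun y => (χ y : ℂ) * exp (ℓ y)) x‖ ≤
      2 ^ n * B * (1 + ‖ℓ‖) ^ n * Real.exp A * Real.exp (-(c * ‖x‖)) := by
  have hB0 : 0 ≤ B := (norm_nonneg _).trans (hB 0 (Nat.zero_le _) x)
  by_cases hx : x ∈ tsupport χ
  · have h1 : ∀ i ≤ n, ‖iteratedFDeriv ℝ i (fun y => (χ y : ℂ)) x‖ ≤ B := fun i hi => by
      rw [norm_iteratedFDeriv_ofReal_comp hχ]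
      exact hB i hi x
    have h2 : ∀ i ≤ n, ‖iteratedFDeriv ℝ i (fun y => exp (ℓ y)) x‖ ≤
        (1 + ‖ℓ‖) ^ n * Real.exp (ℓ x).re := fun i hi => by
      calc ‖iteratedFDeriv ℝ i (fun y => exp (ℓ y)) x‖ ≤ Real.exp (ℓ x).re * ‖ℓ‖ ^ i :=
            norm_iteratedFDeriv_cexp_comp_le' ℓ i x
        _ ≤ Real.exp (ℓ x).re * (1 + ‖ℓ‖) ^ n := by
            gcongr
            calc ‖ℓ‖ ^ i ≤ (1 + ‖ℓ‖) ^ i := by gcongr; linarith [norm_nonneg ℓ]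
              _ ≤ (1 + ‖ℓ‖) ^ n := pow_le_pow_right₀ (by linarith [norm_nonneg ℓ]) hi
        _ = (1 + ‖ℓ‖) ^ n * Real.exp (ℓ x).re := mul_comm _ _
    calc ‖iteratedFDeriv ℝ n (fun y => (χ y : ℂ) * exp (ℓ y)) x‖
        ≤ 2 ^ n * B * ((1 + ‖ℓ‖) ^ n * Real.exp (ℓ x).re) :=
          norm_iteratedFDeriv_mul_le_of_le (contDiff_ofReal_comp hχ) (contDiff_cexp_comp ℓ) h1 h2
      _ ≤ 2 ^ n * B * ((1 + ‖ℓ‖) ^ n * Real.exp (A - c * ‖x‖)) := by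
          gcongr
          exact hℓ x hx
      _ = 2 ^ n * B * (1 + ‖ℓ‖) ^ n * Real.exp A * Real.exp (-(c * ‖x‖)) := by
          rw [sub_eq_add_neg, Real.exp_add]; ring
  · have hsub : tsupport (fun y => (χ y : ℂ) * exp (ℓ y)) ⊆ tsupport χ := by
      refine (tsupport_mul_subset_left).trans ?_
      exact closure_mono fun y hy => by simpa using hy
    rw [iteratedFDeriv_eq_zero_of_notMem_tsupport (fun h => hx (hsub h)), norm_zero]
    positivity

/-- The kernel `χ eˡ` is smooth. [folklore] -/
theorem contDiff_cutoff_cexp {χ : V → ℝ} (hχ : ContDiff ℝ ∞ χ) (ℓ : V →L[ℝ] ℂ) :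
    ContDiff ℝ ∞ fun y => (χ y : ℂ) * exp (ℓ y) :=
  (contDiff_ofReal_comp hχ).mul (contDiff_cexp_comp ℓ)

/-- **The second-order remainder estimate** (for the complex differentiability of the
Fourier–Laplace transform): with `χ`, `ℓ` as in `norm_iteratedFDeriv_cutoff_cexp_le` and a second
form `ℓ'` with `‖ℓ'‖ ≤ min 1 (c/2)`,
`‖Dⁿ(χ eˡ (e^{ℓ'} − 1 − ℓ'))(x)‖ ≤ 4ⁿ B (1+‖ℓ‖)ⁿ eᴬ ‖ℓ'‖² (1+‖x‖)² e^{-(c/2)‖x‖}`. [folklore] -/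
theorem norm_iteratedFDeriv_cutoff_cexp_remainder_le {χ : V → ℝ} (hχ : ContDiff ℝ ∞ χ) {n : ℕ}
    {B : ℝ} (hB : ∀ i ≤ n, ∀ x, ‖iteratedFDeriv ℝ i χ x‖ ≤ B) (ℓ : V →L[ℝ] ℂ) {c A : ℝ}
    (hℓ : ∀ x ∈ tsupport χ, (ℓ x).re ≤ A - c * ‖x‖) (ℓ' : V →L[ℝ] ℂ) (hℓ'1 : ‖ℓ'‖ ≤ 1)
    (hℓ'c : ‖ℓ'‖ ≤ c / 2) (x : V) :
    ‖iteratedFDeriv ℝ n (fun y => (χ y : ℂ) * exp (ℓ y) * (exp (ℓ' y) - 1 - ℓ' y)) x‖ ≤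
      4 ^ n * B * (1 + ‖ℓ‖) ^ n * Real.exp A * ‖ℓ'‖ ^ 2 * (1 + ‖x‖) ^ 2 *
        Real.exp (-(c / 2 * ‖x‖)) := by
  have hB0 : 0 ≤ B := (norm_nonneg _).trans (hB 0 (Nat.zero_le _) x)
  -- bounds on the kernel and on the remainder factor, in all orders `i ≤ n`
  have h1 : ∀ i ≤ n, ‖iteratedFDeriv ℝ i (fun y => (χ y : ℂ) * exp (ℓ y)) x‖ ≤
      2 ^ n * B * (1 + ‖ℓ‖) ^ n * Real.exp A * Real.exp (-(c * ‖x‖)) := by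
    intro i hi
    refine (norm_iteratedFDeriv_cutoff_cexp_le hχ (fun j hj => hB j (hj.trans hi)) ℓ hℓ x).trans ?_
    have h2i : (2 : ℝ) ^ i ≤ 2 ^ n := pow_le_pow_right₀ (by norm_num) hi
    have hli : (1 + ‖ℓ‖) ^ i ≤ (1 + ‖ℓ‖) ^ n :=
      pow_le_pow_right₀ (by linarith [norm_nonneg ℓ]) hi
    gcongr
  have h2 : ∀ i ≤ n, ‖iteratedFDeriv ℝ i (fun y => exp (ℓ' y) - 1 - ℓ' y) x‖ ≤
      ‖ℓ'‖ ^ 2 * (1 + ‖x‖) ^ 2 * Real.exp (c / 2 * ‖x‖) := by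
    intro i _
    refine (norm_iteratedFDeriv_cexp_comp_sub_one_sub_le ℓ' hℓ'1 i x).trans ?_
    gcongr
    refine max_le ?_ (mul_nonneg ((norm_nonneg _).trans hℓ'c) (norm_nonneg _))
    calc (ℓ' x).re ≤ ‖ℓ' x‖ := Complex.re_le_norm _
      _ ≤ ‖ℓ'‖ * ‖x‖ := ℓ'.le_opNorm x
      _ ≤ c / 2 * ‖x‖ := by gcongr
  have hf : ContDiff ℝ ∞ fun y => (χ y : ℂ) * exp (ℓ y) := contDiff_cutoff_cexp hχ ℓ
  have hg : ContDiff ℝ ∞ fun y => exp (ℓ' y) - 1 - ℓ' y :=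
    ((contDiff_cexp_comp ℓ').sub contDiff_const).sub ℓ'.contDiff
  calc ‖iteratedFDeriv ℝ n (fun y => (χ y : ℂ) * exp (ℓ y) * (exp (ℓ' y) - 1 - ℓ' y)) x‖
      ≤ 2 ^ n * (2 ^ n * B * (1 + ‖ℓ‖) ^ n * Real.exp A * Real.exp (-(c * ‖x‖))) *
          (‖ℓ'‖ ^ 2 * (1 + ‖x‖) ^ 2 * Real.exp (c / 2 * ‖x‖)) :=
        norm_iteratedFDeriv_mul_le_of_le hf hg h1 h2
    _ = 4 ^ n * B * (1 + ‖ℓ‖) ^ n * Real.exp A * ‖ℓ'‖ ^ 2 * (1 + ‖x‖) ^ 2 *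
          (Real.exp (-(c * ‖x‖)) * Real.exp (c / 2 * ‖x‖)) := by
        rw [show (4 : ℝ) ^ n = 2 ^ n * 2 ^ n by rw [← mul_pow]; norm_num]
        ring
    _ = 4 ^ n * B * (1 + ‖ℓ‖) ^ n * Real.exp A * ‖ℓ'‖ ^ 2 * (1 + ‖x‖) ^ 2 *
          Real.exp (-(c / 2 * ‖x‖)) := by
        rw [← Real.exp_add]
        congr 2
        ring

/-- **The boundary-value difference estimate**: for `χ` with `‖Dⁱχ‖ ≤ B`, a form `ℓ'` with
`Re ℓ' ≤ A'` on `tsupport χ` and `‖ℓ'‖ ≤ 1`, and a smooth `ψ` with `‖Dⁱψ(x)‖ ≤ B_ψ` (`i ≤ n`),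
`‖Dⁿ(χ (e^{ℓ'} − 1) ψ)(x)‖ ≤ 4ⁿ B ‖ℓ'‖ (1 + ‖x‖) e^{max(A', 0)} B_ψ`. [folklore] -/
theorem norm_iteratedFDeriv_cutoff_sub_one_mul_le {χ : V → ℝ} (hχ : ContDiff ℝ ∞ χ) {n : ℕ}
    {B : ℝ} (hB : ∀ i ≤ n, ∀ x, ‖iteratedFDeriv ℝ i χ x‖ ≤ B) (ℓ' : V →L[ℝ] ℂ) {A' : ℝ}
    (hℓ' : ∀ x ∈ tsupport χ, (ℓ' x).re ≤ A') (hℓ'1 : ‖ℓ'‖ ≤ 1) {ψ : V → ℂ} (hψ : ContDiff ℝ ∞ ψ)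
    (x : V) {Bψ : ℝ} (hBψ : ∀ i ≤ n, ‖iteratedFDeriv ℝ i ψ x‖ ≤ Bψ) :
    ‖iteratedFDeriv ℝ n (fun y => (χ y : ℂ) * (exp (ℓ' y) - 1) * ψ y) x‖ ≤
      4 ^ n * B * ‖ℓ'‖ * (1 + ‖x‖) * Real.exp (max A' 0) * Bψ := by
  have hB0 : 0 ≤ B := (norm_nonneg _).trans (hB 0 (Nat.zero_le _) x)
  have hBψ0 : 0 ≤ Bψ := (norm_nonneg _).trans (hBψ 0 (Nat.zero_le _))
  have hfg : ContDiff ℝ ∞ fun y => (χ y : ℂ) * (exp (ℓ' y) - 1) :=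
    (contDiff_ofReal_comp hχ).mul ((contDiff_cexp_comp ℓ').sub contDiff_const)
  -- the inner product `χ (e^{ℓ'} − 1)` in all orders `i ≤ n`
  have hinner : ∀ i ≤ n, ‖iteratedFDeriv ℝ i (fun y => (χ y : ℂ) * (exp (ℓ' y) - 1)) x‖ ≤
      2 ^ n * B * (‖ℓ'‖ * (1 + ‖x‖) * Real.exp (max A' 0)) := by
    intro i hi
    by_cases hx : x ∈ tsupport χ
    · have h1 : ∀ j ≤ i, ‖iteratedFDeriv ℝ j (fun y => (χ y : ℂ)) x‖ ≤ B := fun j hj => by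
        rw [norm_iteratedFDeriv_ofReal_comp hχ]
        exact hB j (hj.trans hi) x
      have h2 : ∀ j ≤ i, ‖iteratedFDeriv ℝ j (fun y => exp (ℓ' y) - 1) x‖ ≤
          ‖ℓ'‖ * (1 + ‖x‖) * Real.exp (max A' 0) := by
        intro j _
        refine (norm_iteratedFDeriv_cexp_comp_sub_one_le ℓ' j x).trans ?_
        have hmax : Real.exp (max (ℓ' x).re 0) ≤ Real.exp (max A' 0) :=
          Real.exp_le_exp.2 (max_le_max (hℓ' x hx) le_rfl)
        split_ifs with hj0
        · calc ‖ℓ' x‖ * Real.exp (max (ℓ' x).re 0) ≤ ‖ℓ'‖ * ‖x‖ * Real.exp (max A' 0) := by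
                gcongr
                exact ℓ'.le_opNorm x
            _ ≤ ‖ℓ'‖ * (1 + ‖x‖) * Real.exp (max A' 0) := by
                gcongr; linarith [norm_nonneg x]
        · calc ‖ℓ'‖ ^ j * Real.exp (max (ℓ' x).re 0) ≤ ‖ℓ'‖ * Real.exp (max A' 0) := by
                gcongr
                calc ‖ℓ'‖ ^ j ≤ ‖ℓ'‖ ^ 1 := pow_le_pow_of_le_one (norm_nonneg _) hℓ'1
                      (Nat.one_le_iff_ne_zero.2 hj0)
                  _ = ‖ℓ'‖ := pow_one _
            _ ≤ ‖ℓ'‖ * (1 + ‖x‖) * Real.exp (max A' 0) := by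
                gcongr
                exact le_mul_of_one_le_right (norm_nonneg _) (by linarith [norm_nonneg x])
      calc ‖iteratedFDeriv ℝ i (fun y => (χ y : ℂ) * (exp (ℓ' y) - 1)) x‖
          ≤ 2 ^ i * B * (‖ℓ'‖ * (1 + ‖x‖) * Real.exp (max A' 0)) :=
            norm_iteratedFDeriv_mul_le_of_le (contDiff_ofReal_comp hχ)
              ((contDiff_cexp_comp ℓ').sub contDiff_const) h1 h2
        _ ≤ 2 ^ n * B * (‖ℓ'‖ * (1 + ‖x‖) * Real.exp (max A' 0)) := by
            gcongr
            · norm_num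
    · have hsub : tsupport (fun y => (χ y : ℂ) * (exp (ℓ' y) - 1)) ⊆ tsupport χ := by
        refine (tsupport_mul_subset_left).trans ?_
        exact closure_mono fun y hy => by simpa using hy
      rw [iteratedFDeriv_eq_zero_of_notMem_tsupport (fun h => hx (hsub h)), norm_zero]
      positivity
  calc ‖iteratedFDeriv ℝ n (fun y => (χ y : ℂ) * (exp (ℓ' y) - 1) * ψ y) x‖
      ≤ 2 ^ n * (2 ^ n * B * (‖ℓ'‖ * (1 + ‖x‖) * Real.exp (max A' 0))) * Bψ :=
        norm_iteratedFDeriv_mul_le_of_le hfg hψ hinner hBψ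
    _ = 4 ^ n * B * ‖ℓ'‖ * (1 + ‖x‖) * Real.exp (max A' 0) * Bψ := by
        rw [show (4 : ℝ) ^ n = 2 ^ n * 2 ^ n by rw [← mul_pow]; norm_num]
        ring

end Kernel

/-! ### Geometry of the polar cone -/

section Geometry

variable {V : Type*} [NormedAddCommGroup V] [InnerProductSpace ℝ V] [CompleteSpace V]

/-- The polar cone is closed under multiplication by nonnegative scalars. [folklore] -/
theorem smul_mem_polarCone {S : Set V} {y : V} (hy : y ∈ polarCone S) {t : ℝ} (ht : 0 ≤ t) :
    t • y ∈ polarCone S := by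
  rw [mem_polarCone_iff] at hy ⊢
  intro ξ hξ
  rw [real_inner_smul_left]
  exact mul_nonpos_of_nonneg_of_nonpos ht (hy ξ hξ)

/-- **Positive multiples stay in the interior of the polar cone** (the dilation `x ↦ t x`,
`t > 0`, is a homeomorphism preserving `S⁻`). [folklore] -/
theorem smul_mem_interior_polarCone {S : Set V} {y : V} (hy : y ∈ interior (polarCone S))
    {t : ℝ} (ht : 0 < t) : t • y ∈ interior (polarCone S) := by
  set h : V ≃ₜ V := Homeomorph.smulOfNeZero t ht.ne' with hh
  have himage : (h : V → V) '' polarCone S = polarCone S := by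
    ext x
    constructor
    · rintro ⟨x', hx', rfl⟩
      exact smul_mem_polarCone hx' ht.le
    · intro hx
      refine ⟨t⁻¹ • x, smul_mem_polarCone hx (inv_nonneg.2 ht.le), ?_⟩
      change t • (t⁻¹ • x) = x
      rw [smul_smul, mul_inv_cancel₀ ht.ne', one_smul]
  have key : (h : V → V) '' interior (polarCone S) = interior (polarCone S) := by
    rw [h.image_interior, himage]
  rw [← key]
  exact ⟨y, hy, rfl⟩

/-- **Uniform decay of `⟪y, ·⟫` on the cone**: for a compact subset `M` of the interior of `S⁻`
there is `r > 0` with `⟪y, ξ⟫ ≤ −r‖ξ‖` for all `y ∈ M`, `ξ ∈ S` (the `r`-neighbourhood of `M`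
lies in `S⁻`, and `y + r ξ/‖ξ‖ ∈ S⁻` gives the claim; Hörmander (1990), §7.4, before
Thm. 7.4.3: `θ` is interior to `{H_S < ∞} = S⁻`). [cite: HormanderALPDO1, Thm 7.4.2 and paragraph before Thm 7.4.3] -/
theorem exists_forall_inner_le_neg_mul_norm {S : Set V} {M : Set V} (hM : IsCompact M)
    (hMS : M ⊆ interior (polarCone S)) :
    ∃ r : ℝ, 0 < r ∧ ∀ y ∈ M, ∀ ξ ∈ S, ⟪y, ξ⟫ ≤ -(r * ‖ξ‖) := by
  obtain ⟨r, hr, hsub⟩ := hM.exists_cthickening_subset_open isOpen_interior hMS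
  refine ⟨r, hr, fun y hy ξ hξ => ?_⟩
  rcases eq_or_ne ξ 0 with rfl | hξ0
  · simp
  have hnorm : 0 < ‖ξ‖ := norm_pos_iff.2 hξ0
  -- the point `y + (r/‖ξ‖) ξ` lies in the `r`-neighbourhood of `M`, hence in `S⁻`
  set y' : V := y + (r / ‖ξ‖) • ξ with hy'
  have hy'mem : y' ∈ polarCone S := by
    refine interior_subset (hsub ?_)
    refine Metric.mem_cthickening_of_dist_le y' y r M hy ?_
    rw [hy', dist_eq_norm, add_sub_cancel_left, norm_smul, norm_div, Real.norm_of_nonneg hr.le,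
      norm_norm, div_mul_cancel₀ r hnorm.ne']
  have h := (mem_polarCone_iff.1 hy'mem) ξ hξ
  rw [hy', inner_add_left, real_inner_smul_left, real_inner_self_eq_norm_sq] at h
  have e : r / ‖ξ‖ * ‖ξ‖ ^ 2 = r * ‖ξ‖ := by field_simp
  linarith

omit [CompleteSpace V] in
/-- **From the cone to its uniform neighbourhood**: if `⟪y, ξ⟫ ≤ −r‖ξ‖` on `S` (`r ≥ 0`) then
`⟪y, ξ⟫ ≤ −r‖ξ‖ + δ(r + ‖y‖)` on `thickening δ S`. [folklore] -/
theorem inner_le_of_mem_thickening {S : Set V} {y : V} {r : ℝ} (hr : 0 ≤ r)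
    (hy : ∀ ξ ∈ S, ⟪y, ξ⟫ ≤ -(r * ‖ξ‖)) {δ : ℝ} {ξ : V} (hξ : ξ ∈ thickening δ S) :
    ⟪y, ξ⟫ ≤ -(r * ‖ξ‖) + δ * (r + ‖y‖) := by
  obtain ⟨ξ₀, hξ₀, hd⟩ := mem_thickening_iff.1 hξ
  rw [dist_eq_norm] at hd
  have h1 : ⟪y, ξ⟫ = ⟪y, ξ₀⟫ + ⟪y, ξ - ξ₀⟫ := by rw [← inner_add_right, add_sub_cancel]
  have h2 : ⟪y, ξ - ξ₀⟫ ≤ ‖y‖ * δ :=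
    (real_inner_le_norm _ _).trans (mul_le_mul_of_nonneg_left hd.le (norm_nonneg _))
  have h3 : ‖ξ‖ ≤ ‖ξ₀‖ + δ := by
    calc ‖ξ‖ = ‖ξ₀ + (ξ - ξ₀)‖ := by rw [add_sub_cancel]
      _ ≤ ‖ξ₀‖ + ‖ξ - ξ₀‖ := norm_add_le _ _
      _ ≤ ‖ξ₀‖ + δ := by linarith
  have h4 := hy ξ₀ hξ₀
  nlinarith [norm_nonneg y, norm_nonneg ξ₀]

/-- The two previous facts combined, in the form consumed by the kernel estimates: for a compact
`M ⊆ interior S⁻` there are `r > 0` and `R` with `⟪y, ξ⟫ ≤ −r‖ξ‖ + 3(r + R)` for all `y ∈ M` and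
all `ξ` in the uniform neighbourhood `thickening 3 S`, and `‖y‖ ≤ R` on `M`. [folklore] -/
theorem exists_forall_inner_le_of_subset_interior_polarCone {S : Set V} {M : Set V}
    (hM : IsCompact M) (hMS : M ⊆ interior (polarCone S)) :
    ∃ r R : ℝ, 0 < r ∧ 0 ≤ R ∧ (∀ y ∈ M, ‖y‖ ≤ R) ∧
      ∀ y ∈ M, ∀ ξ ∈ thickening 3 S, ⟪y, ξ⟫ ≤ -(r * ‖ξ‖) + 3 * (r + R) := by
  obtain ⟨r, hr, h⟩ := exists_forall_inner_le_neg_mul_norm hM hMS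
  obtain ⟨R, hR⟩ := hM.isBounded.exists_norm_le
  refine ⟨r, max R 0, hr, le_max_right _ _, fun y hy => (hR y hy).trans (le_max_left _ _),
    fun y hy ξ hξ => ?_⟩
  calc ⟪y, ξ⟫ ≤ -(r * ‖ξ‖) + 3 * (r + ‖y‖) := inner_le_of_mem_thickening hr.le (h y hy) hξ
    _ ≤ -(r * ‖ξ‖) + 3 * (r + max R 0) := by
        gcongr
        exact (hR y hy).trans (le_max_left _ _)

end Geometry

end Literature.Analysis.Distribution
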